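import Mathlib
import HarnessLib
import Summits.HubbardSuperconductivity.HubbardSuperconductivity.Theorems.KLProgrammeKLRegimeTwoCutoffScaleZeroReadout
import Summits.HubbardSuperconductivity.HubbardSuperconductivity.Theorems.KLProgrammeKLRegimeEngineScaleZeroNorms

/-!
# Route `KLProgramme` — ENGINE child `KLRegimeEngineV16` (stmt-HubbardSuperconductivity-20236), `stub_twoLeg_scale0`, conjunct (E3f-AT)₀,
# the CUTOFF leg: the sub-dyadic step bound in CLOSED FORM (cell gate-hubbard-kl, seat hubbard-kl-k3c4-p2 g6; route (C))

Sequel of `…TwoCutoffScaleZeroStep` (§2, parametric profile) and `…TwoCutoffScaleZeroReadout`.  The weights are FIXED (`ρ_C = κ_C = √(2(8+κ²))`,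
`ρ_S = 4e²κ_C`, so that the defect profile's field weights decay like `4^{-m'}`), the defect profile `D` is the near-identity output itself, and every
`normV` is evaluated in closed form (`VS, VC`) or bounded by a geometric sum (`VD`):

* `abs_klLocalPart_zero_twoCutoff_sub_le_of_profile` — the read-out composed with the parametric step;
* **`abs_klLocalPart_zero_twoCutoff_sub_le_closed`** — for `1 ≤ M ≤ M″ ≤ 2M` on the `4M″` grid, with the vertex profile `(n2, n4)`, the shell's
  equal-time entry bound `tE`, row sums `α″` (cutoff-`M″` covariance) and `α_S` (shell) and the infrared constant `κ²`: if
  `θ_S := e·α_S·VS ≤ 1/2` and `θ_C' := e(α″+α_S)(VC+VD)/κ_C² ≤ 1/2` then at every angle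
  `|klLocalPart L M … 0 θ − klLocalPart L M″ … 0 θ| ≤ (2·4M″/|β|)·(4e·VD/κ_C²)`,
  `VS = (e²(1+ρ_S))²n2 + (e²(1+ρ_S))⁴n4`, `VC = (2e²κ_C)²n2 + (2e²κ_C)⁴n4`, `VD = (2e²κ_C)²·6·tE·n4 + (e/3)·VS·θ_S/(1−θ_S)`.
  Since `n2, n4 ∝ β/N` and `(β/N)α_S = O(β/√M)`, `tE = O(β/M)`, the right side is `O(β/√M)` uniformly in the volume (sequel: chaining + thresholds).

Proof only; no definitions; nothing about the model's physics is asserted beyond the stated inequalities.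
-/

noncomputable section

namespace Summit.HubbardSuperconductivity.HubbardSuperconductivity.Theorems.TwoVolumeDefect

set_option linter.dupNamespace false -- summit = problem name (single-conjunct summit), D-0017

open Finset Literature.MathematicalPhysics.QuantumLattice Literature.Probability.LatticeModels GrassmannAlgebra
open Summit.HubbardSuperconductivity.HubbardSuperconductivity.Theorems.KLRegimeSplit

variable {L M M'' : ℕ} [NeZero L]

/-! ## §1 The read-out composed with the parametric step -/

/-- **The two-cutoff difference of the scale-0 local part, parametric form**: the hypotheses of
`sum_norm_kernel_twoCutoff_effAction_sub_le_of_profile` at `Λ = klE0` give, at every angle,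
`|klLocalPart L M … 0 θ − klLocalPart L M″ … 0 θ| ≤ (2·4M″/|β|)·ρ_C^{-2}·e‖D‖_h/(1−θ_C)²`. -/
theorem abs_klLocalPart_zero_twoCutoff_sub_le_of_profile [NeZero M] [NeZero M''] {β : ℝ} (hβ : 0 < β) (h : M ≤ M'') (hM2 : M'' ≤ 2 * M)
    (U μ : ℝ) (K : TrigPolyC4v)
    {κ : ℝ}
    (hIR : 1 / (β * (L : ℝ) ^ 2) * ∑ k : FreqMomentum L M'',
        (1 - hubbardCutoffWeightCT L M'' β μ K klE0 k) / Real.sqrt (matsubaraFreq β M'' k.1 ^ 2 + nambuXiCT L μ K k.2 ^ 2) ≤ κ ^ 2)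
    {aC aS : ℝ} (haC : 0 < aC) (haS : 0 < aS)
    (hrowC : ∀ X, ∑ Y, ‖((hubbardGridSub L M'' β (2 * (2 * M''))).transpose * hubbardCovAboveCT L M'' β μ 0 K klE0 *
      hubbardGridSub L M'' β (2 * (2 * M''))) X Y‖ ≤ aC)
    (hcolC : ∀ Y, ∑ X, ‖((hubbardGridSub L M'' β (2 * (2 * M''))).transpose * hubbardCovAboveCT L M'' β μ 0 K klE0 *
      hubbardGridSub L M'' β (2 * (2 * M''))) X Y‖ ≤ aC)
    (hrowS : ∀ X, ∑ Y, ‖((hubbardGridSub L M'' β (2 * (2 * M''))).transpose * hubbardCovShellCT L h β μ 0 K klE0 *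
      hubbardGridSub L M'' β (2 * (2 * M''))) X Y‖ ≤ aS)
    (hcolS : ∀ Y, ∑ X, ‖((hubbardGridSub L M'' β (2 * (2 * M''))).transpose * hubbardCovShellCT L h β μ 0 K klE0 *
      hubbardGridSub L M'' β (2 * (2 * M''))) X Y‖ ≤ aS)
    {tE : ℝ} (htE0 : 0 ≤ tE)
    (htE : ∀ A B : GridLeg (GridPoint L (2 * (2 * M''))), SameTime A B →
      ‖((hubbardGridSub L M'' β (2 * (2 * M''))).transpose * hubbardCovShellCT L h β μ 0 K klE0 *
        hubbardGridSub L M'' β (2 * (2 * M''))) A B‖ ≤ tE)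
    {n2 n4 : ℝ} (hn2 : 0 ≤ n2) (hn4 : 0 ≤ n4)
    (hNW : ∀ (n : ℕ) (p : Fin n) (w : GridLeg (GridPoint L (2 * (2 * M'')))),
      ∑ Z ∈ univ.filter (fun Z : Fin n → GridLeg (GridPoint L (2 * (2 * M''))) => Z p = w),
        ‖kernel ℂ (hubbardGridInteraction L (2 * (2 * M'')) β U + hubbardGridCounterQuadratic L (2 * (2 * M'')) β K) n Z‖ ≤
          (if n = 4 then n4 else if n = 2 then n2 else 0))
    {ρS ρC : ℝ} (hρS : 0 < ρS) (hρC : 0 < ρC)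
    (hθS : Real.exp 1 * aS * normV (GridLeg (GridPoint L (2 * (2 * M'')))) 1 ρS
        (fun m' => if 2 * m' = 4 then n4 else if 2 * m' = 2 then n2 else 0) / 1 ^ 2 < 1)
    (D : ℕ → ℝ) (hD0 : ∀ m, 0 ≤ D m)
    (hD : ∀ m, 0 < m →
      (if m = 2 then 6 * tE * n4 else 0) +
        ρS⁻¹ ^ m * (Real.exp 1 * normV (GridLeg (GridPoint L (2 * (2 * M'')))) 1 ρS
            (fun m' => if 2 * m' = 4 then n4 else if 2 * m' = 2 then n2 else 0)) *
          (Real.exp 1 * aS * normV (GridLeg (GridPoint L (2 * (2 * M'')))) 1 ρS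
              (fun m' => if 2 * m' = 4 then n4 else if 2 * m' = 2 then n2 else 0) / 1 ^ 2) /
          (1 - Real.exp 1 * aS * normV (GridLeg (GridPoint L (2 * (2 * M'')))) 1 ρS
              (fun m' => if 2 * m' = 4 then n4 else if 2 * m' = 2 then n2 else 0) / 1 ^ 2) ≤ D m)
    (hθC : Real.exp 1 * (aC + aS) *
        (normV (GridLeg (GridPoint L (2 * (2 * M'')))) (Real.sqrt (2 * (8 + κ ^ 2))) ρC
            (fun m' => if 2 * m' = 4 then n4 else if 2 * m' = 2 then n2 else 0) +
          normV (GridLeg (GridPoint L (2 * (2 * M'')))) (Real.sqrt (2 * (8 + κ ^ 2))) ρC (fun m' => D (2 * m'))) /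
        Real.sqrt (2 * (8 + κ ^ 2)) ^ 2 < 1)
    (θ : ℝ) :
    |klLocalPart L M β U μ K 0 θ - klLocalPart L M'' β U μ K 0 θ| ≤
      2 * ((2 * (2 * M'') : ℕ) : ℝ) / |β| *
        (ρC⁻¹ ^ 2 * (Real.exp 1 * normV (GridLeg (GridPoint L (2 * (2 * M'')))) (Real.sqrt (2 * (8 + κ ^ 2))) ρC (fun m' => D (2 * m'))) /
          (1 - Real.exp 1 * (aC + aS) *
            (normV (GridLeg (GridPoint L (2 * (2 * M'')))) (Real.sqrt (2 * (8 + κ ^ 2))) ρC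
                (fun m' => if 2 * m' = 4 then n4 else if 2 * m' = 2 then n2 else 0) +
              normV (GridLeg (GridPoint L (2 * (2 * M'')))) (Real.sqrt (2 * (8 + κ ^ 2))) ρC (fun m' => D (2 * m'))) /
            Real.sqrt (2 * (8 + κ ^ 2)) ^ 2) ^ 2) := by
  haveI : NeZero (2 * (2 * M'')) := ⟨by have := NeZero.ne M''; omega⟩
  refine abs_klLocalPart_zero_twoCutoff_sub_le_of_grid hβ.ne' U μ K _ _
    (klEffectiveAction_zero_eq_map_gridSub hβ.ne' U μ K (by omega) (by omega)) (fun k σ => klSelfEnergy_zero_twoCutoff_eq h hβ.ne' U μ K k σ)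
    (fun σ w => ?_) θ
  exact sum_norm_kernel_twoCutoff_effAction_sub_le_of_profile hβ h hM2 U μ K klE0 hIR haC haS hrowC hcolC hrowS hcolS htE0 htE hn2 hn4 hNW
    hρS hρC hθS D hD0 hD hθC two_pos 0 w

/-! ## §2 Closed forms of the field-weighted norms -/

/-- **Closed form of `‖·‖_h` for a profile supported in degrees `2` and `4`**: `normV Γ κ ρ prof = (e²(κ+ρ))²·n2 + (e²(κ+ρ))⁴·n4` (`|Γ| ≥ 4`). -/
theorem normV_profile24_eq {Γ : Type*} [Fintype Γ] (hΓ : 4 ≤ Fintype.card Γ) (κ ρ n2 n4 : ℝ) :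
    normV Γ κ ρ (fun m' => if 2 * m' = 4 then n4 else if 2 * m' = 2 then n2 else 0) =
      (Real.exp 2 * (κ + ρ)) ^ 2 * n2 + (Real.exp 2 * (κ + ρ)) ^ 4 * n4 := by
  rw [normV]
  have h3 : 3 ≤ Fintype.card Γ / 2 + 1 := by omega
  rw [← sum_range_add_sum_Ico _ h3]
  have htail : ∑ m' ∈ Ico 3 (Fintype.card Γ / 2 + 1),
      (Real.exp 2 * (κ + ρ)) ^ (2 * m') * (if 2 * m' = 4 then n4 else if 2 * m' = 2 then n2 else 0) = 0 := by
    refine sum_eq_zero fun m' hm' => ?_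
    have h3m : 3 ≤ m' := (mem_Ico.1 hm').1
    rw [if_neg (by omega), if_neg (by omega), mul_zero]
  rw [htail, add_zero, sum_range_succ, sum_range_succ, sum_range_succ, sum_range_zero]
  norm_num

/-- **The geometric bound of `‖D‖_h` for the defect profile** `D(m) = [m=2]·c₂ + ρ_S^{-m}·E` (`m ≥ 1`; `D(0) = 0`) at weights `κ = ρ = κ_C`,
`ρ_S = 4e²κ_C`: `normV Γ κ_C κ_C (D∘(2·)) ≤ (2e²κ_C)²·c₂ + E/3` (`(2e²κ_C/ρ_S)^{2m'} = 4^{-m'}`, `Σ_{m'≥1} 4^{-m'} = 1/3`). -/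
theorem normV_defectProfile_le {Γ : Type*} [Fintype Γ] {κC c₂ E : ℝ} (hκC : 0 < κC) (hc₂ : 0 ≤ c₂) (hE : 0 ≤ E) :
    normV Γ κC κC (fun m' => if 2 * m' = 0 then 0 else
        ((if 2 * m' = 2 then c₂ else 0) + (4 * Real.exp 2 * κC)⁻¹ ^ (2 * m') * E)) ≤
      (Real.exp 2 * (κC + κC)) ^ 2 * c₂ + E / 3 := by
  rw [normV]
  set K : ℕ := Fintype.card Γ / 2 + 1 with hK
  set q : ℝ := Real.exp 2 * (κC + κC) with hq
  have hq0 : 0 < q := by positivity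
  have hratio : ∀ m' : ℕ, q ^ (2 * m') * (4 * Real.exp 2 * κC)⁻¹ ^ (2 * m') = (1 / 4 : ℝ) ^ m' := by
    intro m'
    rw [← mul_pow, pow_mul, hq]
    congr 1
    have he : Real.exp 2 ≠ 0 := (Real.exp_pos 2).ne'
    field_simp
    ring
  -- termwise: the `m'`-th term is `[m'=1] q² c₂ + [m' ≥ 1] (1/4)^{m'} E`
  have hterm : ∀ m' ∈ range K, q ^ (2 * m') * (if 2 * m' = 0 then 0 else ((if 2 * m' = 2 then c₂ else 0) + (4 * Real.exp 2 * κC)⁻¹ ^ (2 * m') * E)) =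
      (if m' = 1 then q ^ 2 * c₂ else 0) + (if m' = 0 then 0 else (1 / 4 : ℝ) ^ m' * E) := by
    intro m' _
    rcases Nat.eq_zero_or_pos m' with rfl | hm'
    · simp
    · rw [if_neg (show ¬(2 * m' = 0) by omega), if_neg (show ¬(m' = 0) by omega), mul_add, ← mul_assoc, hratio m']
      by_cases h1 : m' = 1
      · subst h1
        rw [if_pos (show 2 * 1 = 2 from rfl), if_pos rfl, show (2 * 1 : ℕ) = 2 from rfl]
      · rw [if_neg (show ¬(2 * m' = 2) by omega), if_neg h1, mul_zero, zero_add]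
  rw [sum_congr rfl hterm, sum_add_distrib]
  have hA : ∑ m' ∈ range K, (if m' = 1 then q ^ 2 * c₂ else 0) ≤ q ^ 2 * c₂ := by
    rw [Finset.sum_ite_eq' (range K) (1 : ℕ) (fun _ => q ^ 2 * c₂)]
    by_cases h1 : (1 : ℕ) ∈ range K
    · rw [if_pos h1]
    · rw [if_neg h1]; positivity
  have hB : ∑ m' ∈ range K, (if m' = 0 then 0 else (1 / 4 : ℝ) ^ m' * E) ≤ E / 3 := by
    have hgeom : ∑ m' ∈ range K, (1 / 4 : ℝ) ^ m' = 4 / 3 * (1 - (1 / 4 : ℝ) ^ K) := by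
      rw [geom_sum_eq (x := (1 / 4 : ℝ)) (by norm_num) K]
      ring
    have hsplit : ∑ m' ∈ range K, (if m' = 0 then 0 else (1 / 4 : ℝ) ^ m' * E) =
        (∑ m' ∈ range K, (1 / 4 : ℝ) ^ m') * E - E := by
      have hK1 : 1 ≤ K := by rw [hK]; omega
      rw [sum_mul, ← sum_range_add_sum_Ico _ hK1, ← sum_range_add_sum_Ico (fun m' => (1 / 4 : ℝ) ^ m' * E) hK1, sum_range_one,
        sum_range_one, pow_zero, one_mul, if_pos rfl, zero_add]
      rw [sum_congr rfl fun m' hm' => if_neg (show ¬(m' = 0) from by have := (mem_Ico.1 hm').1; omega)]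
      ring
    rw [hsplit, hgeom]
    have hpow : 0 ≤ (1 / 4 : ℝ) ^ K := by positivity
    nlinarith [mul_nonneg hpow hE]
  linarith

/-! ## §3 The step bound in closed form -/

/-- **THE SUB-DYADIC STEP OF THE CUTOFF LEG IN CLOSED FORM.**  See the module docstring: the abbreviations `κ_C, ρ_S, VS, θ_S, VC, VD` are
passed as real parameters with their defining equations (`κ_C = √(2(8+κ²))`, `ρ_S = 4e²κ_C`, `VS = (e²(1+ρ_S))²n2 + (e²(1+ρ_S))⁴n4`,
`θ_S = e·α_S·VS`, `VC = (e²(κ_C+κ_C))²n2 + (e²(κ_C+κ_C))⁴n4`, `VD = (e²(κ_C+κ_C))²·(6·tE·n4) + (e·VS·θ_S/(1−θ_S))/3`); if `θ_S ≤ 1/2` and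
`e(α″+α_S)(VC+VD)/κ_C² ≤ 1/2` then `|klLocalPart L M … 0 θ − klLocalPart L M″ … 0 θ| ≤ (2·4M″/|β|)·(4e·VD/κ_C²)` at every angle. -/
theorem abs_klLocalPart_zero_twoCutoff_sub_le_closed [NeZero M] [NeZero M''] {β : ℝ} (hβ : 0 < β) (h : M ≤ M'') (hM2 : M'' ≤ 2 * M)
    (U μ : ℝ) (K : TrigPolyC4v)
    {κ : ℝ}
    (hIR : 1 / (β * (L : ℝ) ^ 2) * ∑ k : FreqMomentum L M'',
        (1 - hubbardCutoffWeightCT L M'' β μ K klE0 k) / Real.sqrt (matsubaraFreq β M'' k.1 ^ 2 + nambuXiCT L μ K k.2 ^ 2) ≤ κ ^ 2)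
    {aC aS : ℝ} (haC : 0 < aC) (haS : 0 < aS)
    (hrowC : ∀ X, ∑ Y, ‖((hubbardGridSub L M'' β (2 * (2 * M''))).transpose * hubbardCovAboveCT L M'' β μ 0 K klE0 *
      hubbardGridSub L M'' β (2 * (2 * M''))) X Y‖ ≤ aC)
    (hcolC : ∀ Y, ∑ X, ‖((hubbardGridSub L M'' β (2 * (2 * M''))).transpose * hubbardCovAboveCT L M'' β μ 0 K klE0 *
      hubbardGridSub L M'' β (2 * (2 * M''))) X Y‖ ≤ aC)
    (hrowS : ∀ X, ∑ Y, ‖((hubbardGridSub L M'' β (2 * (2 * M''))).transpose * hubbardCovShellCT L h β μ 0 K klE0 *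
      hubbardGridSub L M'' β (2 * (2 * M''))) X Y‖ ≤ aS)
    (hcolS : ∀ Y, ∑ X, ‖((hubbardGridSub L M'' β (2 * (2 * M''))).transpose * hubbardCovShellCT L h β μ 0 K klE0 *
      hubbardGridSub L M'' β (2 * (2 * M''))) X Y‖ ≤ aS)
    {tE : ℝ} (htE0 : 0 ≤ tE)
    (htE : ∀ A B : GridLeg (GridPoint L (2 * (2 * M''))), SameTime A B →
      ‖((hubbardGridSub L M'' β (2 * (2 * M''))).transpose * hubbardCovShellCT L h β μ 0 K klE0 *
        hubbardGridSub L M'' β (2 * (2 * M''))) A B‖ ≤ tE)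
    {n2 n4 : ℝ} (hn2 : 0 ≤ n2) (hn4 : 0 ≤ n4)
    (hNW : ∀ (n : ℕ) (p : Fin n) (w : GridLeg (GridPoint L (2 * (2 * M'')))),
      ∑ Z ∈ univ.filter (fun Z : Fin n → GridLeg (GridPoint L (2 * (2 * M''))) => Z p = w),
        ‖kernel ℂ (hubbardGridInteraction L (2 * (2 * M'')) β U + hubbardGridCounterQuadratic L (2 * (2 * M'')) β K) n Z‖ ≤
          (if n = 4 then n4 else if n = 2 then n2 else 0))
    {κC ρS VS θS VC VD : ℝ} (hκC : κC = Real.sqrt (2 * (8 + κ ^ 2))) (hρS : ρS = 4 * Real.exp 2 * κC)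
    (hVS : VS = (Real.exp 2 * (1 + ρS)) ^ 2 * n2 + (Real.exp 2 * (1 + ρS)) ^ 4 * n4) (hθSdef : θS = Real.exp 1 * aS * VS)
    (hVC : VC = (Real.exp 2 * (κC + κC)) ^ 2 * n2 + (Real.exp 2 * (κC + κC)) ^ 4 * n4)
    (hVD : VD = (Real.exp 2 * (κC + κC)) ^ 2 * (6 * tE * n4) + (Real.exp 1 * VS * θS / (1 - θS)) / 3)
    (hθS : θS ≤ 1 / 2) (hθC : Real.exp 1 * (aC + aS) * (VC + VD) / κC ^ 2 ≤ 1 / 2)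
    (θ : ℝ) :
    |klLocalPart L M β U μ K 0 θ - klLocalPart L M'' β U μ K 0 θ| ≤
      2 * ((2 * (2 * M'') : ℕ) : ℝ) / |β| * (4 * Real.exp 1 * VD / κC ^ 2) := by
  haveI : NeZero (2 * (2 * M'')) := ⟨by have := NeZero.ne M''; omega⟩
  set E : ℝ := Real.exp 1 * VS * θS / (1 - θS) with hE
  have hκC0 : 0 < κC := by rw [hκC]; exact Real.sqrt_pos.2 (by positivity)
  have hρS0 : 0 < ρS := by rw [hρS]; positivity
  have hVS0 : 0 ≤ VS := by rw [hVS]; positivity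
  have hθS0 : 0 ≤ θS := by rw [hθSdef]; positivity
  have hθS1 : θS < 1 := by linarith
  have hE0 : 0 ≤ E := by rw [hE]; exact div_nonneg (by positivity) (by linarith)
  have hVD0 : 0 ≤ VD := by rw [hVD]; positivity
  have hVC0 : 0 ≤ VC := by rw [hVC]; positivity
  have hΓ : 4 ≤ Fintype.card (GridLeg (GridPoint L (2 * (2 * M'')))) := EngineV8.four_le_card_gridLeg
  -- the closed forms
  have hnS : normV (GridLeg (GridPoint L (2 * (2 * M'')))) 1 ρS (fun m' => if 2 * m' = 4 then n4 else if 2 * m' = 2 then n2 else 0) = VS := by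
    rw [hVS]; exact normV_profile24_eq hΓ 1 ρS n2 n4
  have hnC : normV (GridLeg (GridPoint L (2 * (2 * M'')))) κC κC (fun m' => if 2 * m' = 4 then n4 else if 2 * m' = 2 then n2 else 0) = VC := by
    rw [hVC]; exact normV_profile24_eq hΓ κC κC n2 n4
  -- the defect profile
  set D : ℕ → ℝ := fun m => if m = 0 then 0 else ((if m = 2 then 6 * tE * n4 else 0) + ρS⁻¹ ^ m * E) with hDdef
  have hD0 : ∀ m, 0 ≤ D m := fun m => by
    simp only [hDdef]; split_ifs <;> positivity
  have hDm : ∀ m, 0 < m → (if m = 2 then 6 * tE * n4 else 0) +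
      ρS⁻¹ ^ m * (Real.exp 1 * normV (GridLeg (GridPoint L (2 * (2 * M'')))) 1 ρS
          (fun m' => if 2 * m' = 4 then n4 else if 2 * m' = 2 then n2 else 0)) *
        (Real.exp 1 * aS * normV (GridLeg (GridPoint L (2 * (2 * M'')))) 1 ρS
            (fun m' => if 2 * m' = 4 then n4 else if 2 * m' = 2 then n2 else 0) / 1 ^ 2) /
        (1 - Real.exp 1 * aS * normV (GridLeg (GridPoint L (2 * (2 * M'')))) 1 ρS
            (fun m' => if 2 * m' = 4 then n4 else if 2 * m' = 2 then n2 else 0) / 1 ^ 2) ≤ D m := by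
    intro m hm
    rw [hnS, hDdef]
    dsimp only
    rw [if_neg hm.ne', one_pow, div_one, ← hθSdef, hE]
    refine le_of_eq ?_
    ring
  have hnD : normV (GridLeg (GridPoint L (2 * (2 * M'')))) κC κC (fun m' => D (2 * m')) ≤ VD := by
    have hfun : (fun m' => D (2 * m')) = fun m' => if 2 * m' = 0 then 0 else
        ((if 2 * m' = 2 then 6 * tE * n4 else 0) + (4 * Real.exp 2 * κC)⁻¹ ^ (2 * m') * E) := by
      funext m'; simp only [hDdef, hρS]
    rw [hfun, hVD]
    exact normV_defectProfile_le hκC0 (by positivity) hE0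
  -- the smallness conditions in the form of the parametric step
  have hθS' : Real.exp 1 * aS * normV (GridLeg (GridPoint L (2 * (2 * M'')))) 1 ρS
      (fun m' => if 2 * m' = 4 then n4 else if 2 * m' = 2 then n2 else 0) / 1 ^ 2 < 1 := by
    rw [hnS, one_pow, div_one, ← hθSdef]; exact hθS1
  set θCa : ℝ := Real.exp 1 * (aC + aS) *
    (normV (GridLeg (GridPoint L (2 * (2 * M'')))) κC κC (fun m' => if 2 * m' = 4 then n4 else if 2 * m' = 2 then n2 else 0) +
      normV (GridLeg (GridPoint L (2 * (2 * M'')))) κC κC (fun m' => D (2 * m'))) / κC ^ 2 with hθCa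
  have hθCa_le : θCa ≤ Real.exp 1 * (aC + aS) * (VC + VD) / κC ^ 2 := by
    rw [hθCa, hnC]
    exact div_le_div_of_nonneg_right (mul_le_mul_of_nonneg_left (add_le_add le_rfl hnD) (by positivity)) (by positivity)
  have hθCa_half : θCa ≤ 1 / 2 := hθCa_le.trans hθC
  have hθCa0 : 0 ≤ θCa := by
    rw [hθCa]
    exact div_nonneg (mul_nonneg (by positivity) (add_nonneg (by rw [hnC]; exact hVC0)
      (normV_nonneg hκC0.le hκC0.le fun m' => hD0 _))) (by positivity)
  have hθCa1 : θCa < 1 := by linarith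
  -- the parametric bound
  have hmain := abs_klLocalPart_zero_twoCutoff_sub_le_of_profile (L := L) hβ h hM2 U μ K hIR haC haS hrowC hcolC hrowS hcolS htE0 htE hn2 hn4
    hNW hρS0 hκC0 hθS' D hD0 hDm (by rw [← hκC, ← hθCa]; exact hθCa1) θ
  rw [← hκC, ← hθCa] at hmain
  refine hmain.trans (mul_le_mul_of_nonneg_left ?_ (by positivity))
  -- `κC⁻² · e·‖D‖_h / (1 − θ)² ≤ 4e·VD/κC²`
  have hden : (1 / 4 : ℝ) ≤ (1 - θCa) ^ 2 := by nlinarith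
  calc κC⁻¹ ^ 2 * (Real.exp 1 * normV (GridLeg (GridPoint L (2 * (2 * M'')))) κC κC (fun m' => D (2 * m'))) / (1 - θCa) ^ 2
      ≤ κC⁻¹ ^ 2 * (Real.exp 1 * VD) / (1 / 4) := by
        refine div_le_div₀ (by positivity) (mul_le_mul_of_nonneg_left (mul_le_mul_of_nonneg_left hnD (by positivity)) (by positivity))
          (by norm_num) hden
    _ = 4 * Real.exp 1 * VD / κC ^ 2 := by
        rw [inv_pow]
        field_simp

end Summit.HubbardSuperconductivity.HubbardSuperconductivity.Theorems.TwoVolumeDefect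

end
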